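import Summits.MatrixMultiplication.OmegaCensus.STPPSmallPatternTSFProductRoute
import Summits.MatrixMultiplication.OmegaCensus.STPPSmallPatternT2K4OrderLaw
import Summits.MatrixMultiplication.OmegaCensus.STPPSmallPatternEvenOrderLift
import Summits.MatrixMultiplication.OmegaCensus.STPPSmallPatternT2K5OrderLaw
import Summits.MatrixMultiplication.OmegaCensus.STPPSmallPatternT2K7OrderLaw
import Summits.MatrixMultiplication.OmegaCensus.STPPSmallPatternT2K8OrderLaw
import Summits.MatrixMultiplication.OmegaCensus.STPP222PowFromCardPoly
import Summits.MatrixMultiplication.OmegaCensus.STPPTricoloredCoprime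
import Summits.MatrixMultiplication.OmegaCensus.STPPSmallPatternT2K4Order32
import Summits.MatrixMultiplication.OmegaCensus.STPPSmallPatternT1T1ProductRoute
import Summits.MatrixMultiplication.OmegaCensus.STPPSmallPatternT1K4OrderLaw
import Summits.MatrixMultiplication.OmegaCensus.STPPSmallPatternT1K6OrderLaw
import Summits.MatrixMultiplication.OmegaCensus.STPPSmallPatternT1K7OrderLaw
import Summits.MatrixMultiplication.OmegaCensus.STPPSmallPatternT1K9OrderLaw

/-!
# ω-census, `(1,2,2)¹⁶` host law «order ≥ 324»: seed types by the PRODUCT ROUTE, block N (no search; gen-28 `T1 × T1` route; `ℤ/7 × ℤ/7 × ℤ/7` is the worked instance of `STPPSmallPatternT1T1ProductRoute.lean`)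

HONEST FRAMING (pub-omega census; verbatim): lottery ticket; floor = certified bounds/negative ranges.
Census STRUCTURE bookkeeping of the STPP track (seat pub-omega-stpp-3, gen 27; STRUCTURE row B5, column `T2`, §2 C10 row 16), not progress on `ω`:
small patterns in small groups bound no exponent.

Seed types of the domination core `STPPSmallPatternT2K16Core*.lean` settled by `STPPSmallPatternTSFProductRoute.lean`: coordinates `K` with a tricolored
sum-free set of size `t` (tree lemmas `exists_isTSF_*`), complementary coordinates `H` hosting `(1,2,2)^⌈16/t⌉` by an all-abelian host law already in the
tree (`k = 2, 3, 4, 5, 6, 7, 8`: orders `≥ 12, 24, 33, 48, 60 ∖ {61, 63}, 76 ∖ {77, 79, 81}, 96 ∖ {97, 99}`; or an order-32 host of `(1,2,2)⁴`), TSFs on coprime blocks by CRT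
(`STPPTricoloredCoprime.lean`), product cut to 16 triples and shuffled into the seed order.  One line each; the only automation
is `simp` on `Nat.card`, `norm_num`, and `rfl`.  Generator HOME `pub-omega-stpp-3-g28/code/k28/mk_prodseeds2.py` (gen 27; gen 28: CRT coprime TSF blocks, cyclic 3-AP-free table, order-32 hosts) (block 1 of 1, 5 seed types).

References: H. Cohn, R. Kleinberg, B. Szegedy, C. Umans, FOCS 2005 (arXiv:math/0511460), Def. 5.1; Blasiak–Church–Cohn–Grochow–Naslund–Sawin–Umans,
Discrete Analysis 2017:3, Def. 3.1.
-/

open Literature.Computability.AlgebraicComplexity Literature.Combinatorics.Additive Finset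

namespace Summit.MatrixMultiplication.OmegaCensus

/-- **`(1,2,2)¹⁶ ⊆ ℤ/49 × ℤ/7`** (order `343`), `T1 × T1` product route, no search: `(2,1,1)⁸ ⊆ ℤ/49` (order `49 ≥ 45`) times `(2,1,1)² ⊆ ℤ/7` (order `7 ≥ 6`), ENG2's order laws, roles rotated to `(1,2,1) × (1,1,2)` (`8·2 ≥ 16`, cut to 16). [cite: CohnKleinbergSzegedyUmans2005, Def. 5.1] -/
theorem exists_isSTPP_122pow16_seed_49_7 :
    ∃ A B C : Fin 16 → Finset (ZMod 49 × ZMod 7), IsSTPP A B C ∧ ∀ i, (A i).card = 1 ∧ (B i).card = 2 ∧ (C i).card = 2 :=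
  exists_isSTPP_122_prod_of_211_le (H₁ := ZMod 49) (H₂ := ZMod 7)
    (exists_isSTPP_211pow8_of_card_ge_45 (G := ZMod 49) (by simp))
    (exists_isSTPP_211pow2_of_card_ge_6 (G := ZMod 7) (by simp)) 16 (by norm_num)

/-- **`(1,2,2)¹⁶ ⊆ ℤ/19 × ℤ/19`** (order `361`), `T1 × T1` product route, no search: `(2,1,1)⁴ ⊆ ℤ/19` (order `19 ≥ 18`) times `(2,1,1)⁴ ⊆ ℤ/19` (order `19 ≥ 18`), ENG2's order laws, roles rotated to `(1,2,1) × (1,1,2)` (`4·4 ≥ 16`, cut to 16). [cite: CohnKleinbergSzegedyUmans2005, Def. 5.1] -/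
theorem exists_isSTPP_122pow16_seed_19_19 :
    ∃ A B C : Fin 16 → Finset (ZMod 19 × ZMod 19), IsSTPP A B C ∧ ∀ i, (A i).card = 1 ∧ (B i).card = 2 ∧ (C i).card = 2 :=
  exists_isSTPP_122_prod_of_211_le (H₁ := ZMod 19) (H₂ := ZMod 19)
    (exists_isSTPP_211pow4_of_card_ge_18 (G := ZMod 19) (by simp))
    (exists_isSTPP_211pow4_of_card_ge_18 (G := ZMod 19) (by simp)) 16 (by norm_num)

/-- **`(1,2,2)¹⁶ ⊆ ℤ/8 × ℤ/7 × ℤ/7`** (order `392`), `T1 × T1` product route, no search: `(2,1,1)² ⊆ ℤ/8` (order `8 ≥ 6`) times `(2,1,1)⁸ ⊆ ℤ/7 × ℤ/7` (order `49 ≥ 45`), ENG2's order laws, roles rotated to `(1,2,1) × (1,1,2)` (`2·8 ≥ 16`, cut to 16). [cite: CohnKleinbergSzegedyUmans2005, Def. 5.1] -/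
theorem exists_isSTPP_122pow16_seed_8_7_7 :
    ∃ A B C : Fin 16 → Finset (ZMod 8 × ZMod 7 × ZMod 7), IsSTPP A B C ∧ ∀ i, (A i).card = 1 ∧ (B i).card = 2 ∧ (C i).card = 2 :=
  exists_isSTPP_122_prod_of_211_le (H₁ := ZMod 8) (H₂ := ZMod 7 × ZMod 7)
    (exists_isSTPP_211pow2_of_card_ge_6 (G := ZMod 8) (by simp))
    (exists_isSTPP_211pow8_of_card_ge_45 (G := ZMod 7 × ZMod 7) (by simp)) 16 (by norm_num)

/-- **`(1,2,2)¹⁶ ⊆ ℤ/23 × ℤ/4 × ℤ/2 × ℤ/2`** (order `368`), `T1 × T1` product route, no search: `(2,1,1)⁸ ⊆ ℤ/23 × ℤ/2` (order `46 ≥ 45`) times `(2,1,1)² ⊆ ℤ/4 × ℤ/2` (order `8 ≥ 6`), ENG2's order laws, roles rotated to `(1,2,1) × (1,1,2)` (`8·2 ≥ 16`, cut to 16), carried to the seed order by an `rfl` coordinate shuffle. [cite: CohnKleinbergSzegedyUmans2005, Def. 5.1] -/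
theorem exists_isSTPP_122pow16_seed_23_4_2_2 :
    ∃ A B C : Fin 16 → Finset (ZMod 23 × ZMod 4 × ZMod 2 × ZMod 2), IsSTPP A B C ∧ ∀ i, (A i).card = 1 ∧ (B i).card = 2 ∧ (C i).card = 2 :=
  exists_isSTPP_122_prod_of_211_le_of_leftInverse (H₁ := ZMod 23 × ZMod 2) (H₂ := ZMod 4 × ZMod 2)
    (exists_isSTPP_211pow8_of_card_ge_45 (G := ZMod 23 × ZMod 2) (by simp))
    (exists_isSTPP_211pow2_of_card_ge_6 (G := ZMod 4 × ZMod 2) (by simp)) 16 (by norm_num)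
    (AddMonoidHom.mk' (fun x => (x.1.1, x.2.1, x.1.2, x.2.2)) (fun _ _ => rfl))
    (fun y => ((y.1, y.2.2.1), (y.2.1, y.2.2.2))) (fun _ => rfl)

/-- **`(1,2,2)¹⁶ ⊆ ℤ/23 × ℤ/2 × ℤ/2 × ℤ/2 × ℤ/2`** (order `368`), `T1 × T1` product route, no search: `(2,1,1)⁸ ⊆ ℤ/23 × ℤ/2` (order `46 ≥ 45`) times `(2,1,1)² ⊆ ℤ/2 × ℤ/2 × ℤ/2` (order `8 ≥ 6`), ENG2's order laws, roles rotated to `(1,2,1) × (1,1,2)` (`8·2 ≥ 16`, cut to 16), carried to the seed order by an `rfl` coordinate shuffle. [cite: CohnKleinbergSzegedyUmans2005, Def. 5.1] -/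
theorem exists_isSTPP_122pow16_seed_23_2_2_2_2 :
    ∃ A B C : Fin 16 → Finset (ZMod 23 × ZMod 2 × ZMod 2 × ZMod 2 × ZMod 2), IsSTPP A B C ∧ ∀ i, (A i).card = 1 ∧ (B i).card = 2 ∧ (C i).card = 2 :=
  exists_isSTPP_122_prod_of_211_le_of_leftInverse (H₁ := ZMod 23 × ZMod 2) (H₂ := ZMod 2 × ZMod 2 × ZMod 2)
    (exists_isSTPP_211pow8_of_card_ge_45 (G := ZMod 23 × ZMod 2) (by simp))
    (exists_isSTPP_211pow2_of_card_ge_6 (G := ZMod 2 × ZMod 2 × ZMod 2) (by simp)) 16 (by norm_num)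
    (AddMonoidHom.mk' (fun x => (x.1.1, x.1.2, x.2.1, x.2.2.1, x.2.2.2)) (fun _ _ => rfl))
    (fun y => ((y.1, y.2.1), (y.2.2.1, (y.2.2.2.1, y.2.2.2.2)))) (fun _ => rfl)

end Summit.MatrixMultiplication.OmegaCensus
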